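import Summits.QuantumFields.YangMills.Theorems.SoloBlindRPCauchySchwarz
import Summits.QuantumFields.YangMills.Theorems.SoloBlindTwoPointRP
import HarnessLib

/-!
# Log-convexity of the plaquette two-point function along the time axis
(solo-QuantumFields-blind, rung D7⁺, part 3)

Let `ψ_x = φ_{x;ij} − c` be a spatial plaquette observable (`i, j ≠ 0`) shifted by an arbitrary
constant `c` (for `c = ⟨φ⟩` the products below are connected correlations).  For two base points
`y` and `z = y + s·e₀` in the positive-time half of the even torus (same spatial position, times
`y₀, z₀ ∈ [1, L/2]`) and every `β ≥ 0`:

  `⟨ψ_{θy} ψ_z⟩² ≤ ⟨ψ_{θy} ψ_y⟩ · ⟨ψ_{θz} ψ_z⟩`   (`wilsonExpectation_plaquette_twoPoint_logConvex`).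

In terms of the time separation `n ↦ C(n) = ⟨ψ_0 ψ_{n e₀}⟩` this reads
`C(y₀ + z₀ − 1)² ≤ C(2y₀ − 1) · C(2z₀ − 1)`: the two-point function is LOG-CONVEX between odd
separations — the finite-torus, all-`β` shadow of the Källén–Lehmann / transfer-matrix
representation `C(n) = ∫ λⁿ dν(λ)`.  Ingredients: the Schwarz inequality of link reflection
positivity for real observables (part 2), `(ΘU)_p = U_{θp}` (rung D7) and translation invariance
(for the symmetry `⟨ψ_{θy} ψ_z⟩ = ⟨ψ_{θz} ψ_y⟩`).

References: K. Osterwalder, E. Seiler, Ann. Phys. 110 (1978) 440, §2; E. Seiler, LNP 159 (1982) §2;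
J. Glimm, A. Jaffe, Quantum Physics (2nd ed.) §6.1.  [folklore; typed torus statements this unit's]
-/

open MeasureTheory
open Literature.MathematicalPhysics.QuantumFieldTheory Literature.RepresentationTheory.CompactGroups

noncomputable section

namespace Summit.QuantumFields.YangMills.Theorems.SoloBlind

section SiteLemmas

variable {d L : ℕ} [NeZero d]

/-- Time reflection of a time-translated site: `θ(y + s e₀) = θy − s e₀`. [folklore] -/
theorem timeReflect_add_single_zero' (y : Site d L) (s : ZMod L) :
    (y + Pi.single 0 s : Site d L).timeReflect = y.timeReflect + Pi.single 0 (-s) := by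
  funext k
  by_cases hk : k = 0
  · subst hk
    simp only [Site.timeReflect, Function.update_self, Pi.add_apply, Pi.single_eq_same]
    ring
  · simp [Site.timeReflect, Function.update_of_ne hk, Pi.add_apply, Pi.single_eq_of_ne hk]

end SiteLemmas

section LogConvex

variable {d L N : ℕ} [NeZero d] [NeZero L] {G : Type*} [Group G] [TopologicalSpace G]
  [IsTopologicalGroup G] [CompactSpace G] [MeasurableSpace G] [BorelSpace G]
  (ρ : G →* Matrix (Fin N) (Fin N) ℂ)

omit [NeZero d] [NeZero L] [MeasurableSpace G] [BorelSpace G] in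
/-- The shifted plaquette observable `φ_x − c` is bounded by `2N + |c|`. [folklore] -/
theorem abs_plaquetteCost_sub_le (hρ : Continuous ρ) (x : Site d L) (i j : Fin d) (c : ℝ)
    (U : GaugeConfig d L G) : |plaquetteCost ρ x i j U - c| ≤ 2 * N + |c| :=
  (abs_sub _ _).trans (by gcongr; exact abs_plaquetteCost_le ρ hρ x i j U)

omit [TopologicalSpace G] [IsTopologicalGroup G] [CompactSpace G] [MeasurableSpace G] [BorelSpace G]
  [NeZero L] in
/-- Real form of the positive-time property of `φ_x − c`. [folklore] -/
theorem isPositiveTimeObservable_plaquetteCost_sub_real (x : Site d L) {i j : Fin d} (hi : i ≠ 0)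
    (hj : j ≠ 0) (hx1 : 1 ≤ (x 0).val) (hx2 : (x 0).val ≤ L / 2) (c : ℝ) :
    IsPositiveTimeObservable (fun U : GaugeConfig d L G => plaquetteCost ρ x i j U - c) := by
  intro U V hUV
  simp only [isPositiveTimeObservable_plaquetteCost ρ x hi hj hx1 hx2 U V hUV]

/-- **Symmetry of the reflected two-point function under exchange of the base points** (translation
invariance in time): `⟨ψ_{θy} ψ_{y + s e₀}⟩ = ⟨ψ_{θ(y + s e₀)} ψ_y⟩`. -/
theorem wilsonExpectation_plaquette_twoPoint_symm (β : ℝ) (y : Site d L) (i j : Fin d) (c : ℝ)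
    (s : ZMod L) :
    wilsonExpectation ρ β (fun U =>
        (plaquetteCost ρ y.timeReflect i j U - c) *
          (plaquetteCost ρ (y + Pi.single 0 s) i j U - c)) =
      wilsonExpectation ρ β (fun U =>
        (plaquetteCost ρ (y + Pi.single 0 s : Site d L).timeReflect i j U - c) *
          (plaquetteCost ρ y i j U - c)) := by
  have h1 : (y + Pi.single 0 s : Site d L).timeReflect - -(Pi.single 0 s : Site d L) =
      y.timeReflect := by
    rw [timeReflect_add_single_zero', sub_neg_eq_add, add_assoc, ← Pi.single_add, neg_add_cancel,
      Pi.single_zero, add_zero]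
  have h2 : y - -(Pi.single 0 s : Site d L) = y + Pi.single 0 s := sub_neg_eq_add _ _
  have key : (fun U : GaugeConfig d L G =>
        (plaquetteCost ρ y.timeReflect i j U - c) *
          (plaquetteCost ρ (y + Pi.single 0 s) i j U - c)) =
      (fun U => (plaquetteCost ρ (y + Pi.single 0 s : Site d L).timeReflect i j U - c) *
          (plaquetteCost ρ y i j U - c)) ∘ torusConfigShift (-(Pi.single 0 s : Site d L)) := by
    funext U
    simp only [Function.comp_apply, plaquetteCost, plaquetteHolonomy_torusConfigShift, h1, h2]
  rw [key, wilsonExpectation_comp_torusConfigShift]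

/-- **Log-convexity of the plaquette two-point function along the time axis** (rung D7⁺, part 3).
For `β ≥ 0`, `L` even, a spatial orientation `i, j ≠ 0`, a constant `c`, and base points `y`,
`z = y + s e₀` with `1 ≤ y₀, z₀ ≤ L/2`:
`⟨ψ_{θy} ψ_z⟩² ≤ ⟨ψ_{θy} ψ_y⟩ ⟨ψ_{θz} ψ_z⟩`, `ψ_x = φ_{x;ij} − c`;
i.e. `C(y₀ + z₀ − 1)² ≤ C(2y₀ − 1) C(2z₀ − 1)` for the (connected, if `c = ⟨φ⟩`) two-point
function `C(n)` at time separation `n`. -/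
theorem wilsonExpectation_plaquette_twoPoint_logConvex (hL : Even L) (hρ : Continuous ρ) {β : ℝ}
    (hβ : 0 ≤ β) (y : Site d L) (s : ZMod L) {i j : Fin d} (hi : i ≠ 0) (hj : j ≠ 0) (c : ℝ)
    (hy1 : 1 ≤ (y 0).val) (hy2 : (y 0).val ≤ L / 2)
    (hz1 : 1 ≤ ((y + Pi.single 0 s : Site d L) 0).val)
    (hz2 : ((y + Pi.single 0 s : Site d L) 0).val ≤ L / 2) :
    (wilsonExpectation ρ β (fun U =>
        (plaquetteCost ρ y.timeReflect i j U - c) *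
          (plaquetteCost ρ (y + Pi.single 0 s) i j U - c))) ^ 2 ≤
      wilsonExpectation ρ β (fun U =>
          (plaquetteCost ρ y.timeReflect i j U - c) * (plaquetteCost ρ y i j U - c)) *
        wilsonExpectation ρ β (fun U =>
          (plaquetteCost ρ (y + Pi.single 0 s : Site d L).timeReflect i j U - c) *
            (plaquetteCost ρ (y + Pi.single 0 s) i j U - c)) := by
  set z : Site d L := y + Pi.single 0 s with hz
  have hFm : Measurable (fun U : GaugeConfig d L G => plaquetteCost ρ y i j U - c) :=
    (measurable_plaquetteCost' ρ hρ y i j).sub_const c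
  have hGm : Measurable (fun U : GaugeConfig d L G => plaquetteCost ρ z i j U - c) :=
    (measurable_plaquetteCost' ρ hρ z i j).sub_const c
  have h := wilsonExpectation_timeReflect_mul_sq_le ρ hL hρ hβ hFm
    ⟨2 * N + |c|, abs_plaquetteCost_sub_le ρ hρ y i j c⟩
    (isPositiveTimeObservable_plaquetteCost_sub_real ρ y hi hj hy1 hy2 c) hGm
    ⟨2 * N + |c|, abs_plaquetteCost_sub_le ρ hρ z i j c⟩
    (isPositiveTimeObservable_plaquetteCost_sub_real ρ z hi hj hz1 hz2 c)
  simp only [plaquetteCost_timeReflect ρ _ _ hi hj] at h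
  exact h (wilsonExpectation_plaquette_twoPoint_symm ρ β y i j c s)

end LogConvex

end Summit.QuantumFields.YangMills.Theorems.SoloBlind

end
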